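import Mathlib
import HarnessLib
import Summits.NavierStokesRegularity.NavierStokesRegularity.Theses.LocalVelCompTubeDoor

/-!
# Route `LocalVelCompTubeDoor` (S10, rung N0-LocalTubeDoorVelComp) — the ASSEMBLY

Cell ns-regularity-ideate, seat p6 (birth filing; the route was opened 2026-08-26T18:03Z from nsreg-p1's staged package).
Both cruxes of the route were landed VERBATIM as theorems while the route was staged
(`…Theorems.LocalVelCompTubeDoorLocalPointZoomVelSlices.localPointZoomVelSlices`, p433414, and
`…Theorems.LocalVelCompTubeDoorVelCompWindowRigidity.velCompWindowRigidity`, p433644); this file records the assembly BY NAME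
against the born Theses decl (closing item stmt-NavierStokesRegularity-19914).

WHAT THIS IS NOT: not a claim about Navier–Stokes regularity (Clay A).  The leaf is a regularity CRITERION (local Type I
+ one fading Cartesian velocity component on one similarity window ⇒ backward bounded), one rung of LADDER-NS N0;
establishment in the cell's sense still requires the cross-family referee PASS + independent reproduction.
-/

noncomputable section

-- the summit and its single sub-problem share the name (CONVENTIONS §1), as in every Theorems file
set_option linter.dupNamespace false

namespace Summit.NavierStokesRegularity.NavierStokesRegularity.Theorems.LocalVelCompTubeDoorAssembly

open Summit.NavierStokesRegularity.NavierStokesRegularity.Theses.LocalVelCompTubeDoor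

/-- **The route's `Assembly` (item stmt-NavierStokesRegularity-19914)**: `LocalPointZoomVelSlices → VelCompWindowRigidity → Target`,
by the gate-certified deciding theorem `closes`. -/
theorem assembly_proof :
    Summit.NavierStokesRegularity.NavierStokesRegularity.Theses.LocalVelCompTubeDoor.Assembly :=
  fun h₁ h₂ => closes h₁ h₂

end Summit.NavierStokesRegularity.NavierStokesRegularity.Theorems.LocalVelCompTubeDoorAssembly

end
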